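import Summits.BirchSwinnertonDyer.BirchSwinnertonDyer.Theorems.KatoDescentTamePotSupersingularCartanMuRoadFukudaDoorsTprime
import HarnessLib

/-!
# K9 `WildCoatesSujathaResidue` (19942) / U₀-ns node 19189 / item 19197 — the `hram`-FREE FUKUDA doors for U₀ on an O6 (wild `p = 3`) row:
# `MissingUpperBoundAt W 3` from ONE integer equality on the cyclotomic `ℤ_3`-tower of `ℚ(P) = ℚ(W[3])^c`
# (cell `bsd-potss`, seat `bsd-potss-k8t-c4` g19 — K9 courtesy twin of `…CartanMuRoadFukudaDoorsTprime` §3; route-free;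
# `--supports stmt-BirchSwinnertonDyer-19197 --as helper`; closes nothing)

HONEST FRAMING. THEOREMS ONLY (no definition, no named fact, no `sorry`); one-step compositions of LANDED theorems: k9-c4 g18's
`CartanMuRoadRealDoors.missingUpperBoundAt_three_of_{hasSplitCartanNormalizerModPImage_of_realMu, hasModPImageEqNonsplitCartanNormalizer_of_realMu'}`
(U₀ on a rank-`0` O6 row from ONE classical `μ`-hypothesis on `ℚ(P)`), the tree corollaries `classicalMuVanishes_of_classNumberPExp_succ_eq` /
`classicalMuVanishes_of_classGroupPRank_succ_eq` of the NAMED FACTS Fukuda 1994 Thm. 1 (1) / (2), and k8t-c4 g19's THEOREM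
`CartanMuRoadFukudaDoorsTprime.totallyRamifiedFrom_zero_intermediateField_divisionField` (Fukuda's standing index `n₀ = 0` for the
cyclotomic `ℤ_p`-tower of every intermediate field of `ℚ(W[p])` when `W[p]` is irreducible and `ρ̄_{W,p}` not onto — Serre Prop. 15 +
X8 §2), which DISCHARGES the binder `hram` displayed by k9-c4 g19's `UnitIndexMuDoors.missingUpperBoundAt_three_of_…_of_realSuccEqAt` /
`…_of_realRankSuccEqAt` (`…UnitIndexMuDoorsFukudaAt` §4). Displayed per door: the named facts (`hKatoA hGZK hmod hCS hFW hF1/hF2`, + `hI` on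
`3Nn`), `r_an = 0`, `ClassO6 W 3`, `W[3]` irreducible, the image predicate, a complex conjugation `c`, ONE integer equality
(`ord₃ h(ℚ(P)_{n+1}) = ord₃ h(ℚ(P)_n)` or `rank₃ Cl(ℚ(P)_{n+1}) = rank₃ Cl(ℚ(P)_n)`); NO `hram`. K9 use: k9-c4 g19's FukudaAt records
(28566bk1, 371358bt1, 228150bi1/bv1 at `(1,2)`; 261360he1/iv1 rank form) can be re-keyed `hram`-free by one-line substitution. CONDITIONAL on the
named facts; (A), Conjecture A and BSD proved for NO curve; items 19942 / 19189 / 19197 stay OPEN class-wide (open input: zeta crux 24327).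
[cite: Fukuda1994, Thm. 1 (1), (2), p. 264] [cite: CoatesSujatha2005, Thm. 3.4 (§3)] [cite: Kato2004Asterisque, Thm. 14.5 (3) (p. 236)]
[cite: Serre1972, §2.4 Prop. 15, §5.2 (iv)] [cite: Washington1997, §13.1]
-/

set_option linter.dupNamespace false
set_option autoImplicit false

noncomputable section

open scoped Classical NumberField
open Field IntermediateField WeierstrassCurve IsDedekindDomain
  Literature.NumberTheory.EllipticCurves Literature.NumberTheory.EllipticCurves.Rank1Residual
  Literature.NumberTheory.EllipticCurves.Rank1Residual.Typed
  Literature.NumberTheory.GaloisRepresentations Literature.NumberTheory.SerreUniformity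
  Literature.NumberTheory.IwasawaTheory
  Summit.BirchSwinnertonDyer.Rank1Residual Summit.BirchSwinnertonDyer.Rank1Residual.Additive

namespace Summit.BirchSwinnertonDyer.BirchSwinnertonDyer.Theorems.CartanMuRoadFukudaDoorsWild

variable (W : WeierstrassCurve ℚ) [W.IsElliptic] [W.IsGloballyMinimal]

set_option synthInstance.maxHeartbeats 400000 in
set_option maxHeartbeats 4000000 in
/-- **U₀ at a `3Ns` O6 row from Fukuda Thm. 1 (1) on `ℚ(P)` at layers `(n, n+1)`, `hram`-FREE**: `ord₃ #Ш(W) ≤ ord₃ #Ш_an(W)`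
(`MissingUpperBoundAt W 3`) for a rank-`0` row of `ClassO6 W 3` with `W[3]` irreducible and image in `C_s⁺(3)`, from the named facts
`hKatoA hGZK hmod hCS hFW hF1`, a complex conjugation `c` and ONE integer equality `ord₃ h(ℚ(P)_{n+1}) = ord₃ h(ℚ(P)_n)` (`hord`).
CONDITIONAL; nothing booked; BSD for no curve. [cite: Kato2004Asterisque, Thm. 14.5 (3) (p. 236)] [cite: Fukuda1994, Thm. 1 (1), p. 264]
[cite: CoatesSujatha2005, Thm. 3.4 (§3)] [cite: Serre1972, §2.4 Prop. 15, §5.2 (iv)] -/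
theorem missingUpperBoundAt_three_of_hasSplitCartanNormalizerModPImage_of_realSuccEqAt
    (hKatoA : Kato2004.rankZero_padicValNat_sha_add_padicValNat_tamagawa_le_of_additive_potGood_of_irreducible_of_fineSelmerDual_fg)
    (hGZK : rank_eq_analyticRank_of_analyticRank_le_one) (hmod : hasEntireLFunction_rat)
    (hCS : CoatesSujatha2005.thm34_fineSelmerDual_moduleFinite_of_classicalMuVanishes_divisionField)
    (hFW : ferreroWashington1979_classicalMuVanishes) (hF1 : fukuda1994_thm1_classNumberPExp_const_of_succ_eq)
    [Fact (3 : ℕ).Prime] (hr : W.analyticRank = 0) (hO : ClassO6 W 3) (hirr : W.HasIrreducibleModPGaloisRep 3)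
    (himg : HasSplitCartanNormalizerModPImage W 3) {c : absoluteGaloisGroup ℚ} (hc : IsComplexConjugation (Rat.castHom ℝ) c)
    (n : ℕ)
    (hord : ∀ κE : ZpExtension ↥(fixedField (Subgroup.zpowers (absRestrictNormalHom (W.divisionField 3) c))) 3,
      κE.IsCyclotomic → classNumberPExp κE (n + 1) = classNumberPExp κE n) :
    MissingUpperBoundAt W 3 := by
  haveI : NumberField ↥(W.divisionField 3) := NumberField.mk
  exact CartanMuRoadRealDoors.missingUpperBoundAt_three_of_hasSplitCartanNormalizerModPImage_of_realMu W hKatoA hGZK hmod hCS hFW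
    hr hO hirr himg hc
    (fun κE hκE => classicalMuVanishes_of_classNumberPExp_succ_eq hF1 κE
      (CartanMuRoadFukudaDoorsTprime.totallyRamifiedFrom_zero_intermediateField_divisionField W 3 hirr
        (CartanMuRoadFukudaDoorsTprime.not_hasSurjectiveModNGaloisRep_of_hasSplitCartanNormalizerModPImage W himg) _ κE hκE)
      (Nat.zero_le n) (hord κE hκE))

set_option synthInstance.maxHeartbeats 400000 in
set_option maxHeartbeats 4000000 in
/-- **U₀ at a `3Ns` O6 row from Fukuda Thm. 1 (2) (`3`-ranks) on `ℚ(P)` at layers `(n, n+1)`, `hram`-FREE** (named facts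
`hKatoA hGZK hmod hCS hFW hF2`; `rank₃ Cl(ℚ(P)_{n+1}) = rank₃ Cl(ℚ(P)_n)` (`hrk`)) — the door for the RANK-STABLE K9 rows 261360he1 / iv1.
CONDITIONAL; nothing booked; BSD for no curve. [cite: Kato2004Asterisque, Thm. 14.5 (3) (p. 236)] [cite: Fukuda1994, Thm. 1 (2), p. 264]
[cite: CoatesSujatha2005, Thm. 3.4 (§3)] [cite: Serre1972, §2.4 Prop. 15, §5.2 (iv)] -/
theorem missingUpperBoundAt_three_of_hasSplitCartanNormalizerModPImage_of_realRankSuccEqAt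
    (hKatoA : Kato2004.rankZero_padicValNat_sha_add_padicValNat_tamagawa_le_of_additive_potGood_of_irreducible_of_fineSelmerDual_fg)
    (hGZK : rank_eq_analyticRank_of_analyticRank_le_one) (hmod : hasEntireLFunction_rat)
    (hCS : CoatesSujatha2005.thm34_fineSelmerDual_moduleFinite_of_classicalMuVanishes_divisionField)
    (hFW : ferreroWashington1979_classicalMuVanishes) (hF2 : fukuda1994_thm1_classGroupPRank_const_of_succ_eq)
    [Fact (3 : ℕ).Prime] (hr : W.analyticRank = 0) (hO : ClassO6 W 3) (hirr : W.HasIrreducibleModPGaloisRep 3)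
    (himg : HasSplitCartanNormalizerModPImage W 3) {c : absoluteGaloisGroup ℚ} (hc : IsComplexConjugation (Rat.castHom ℝ) c)
    (n : ℕ)
    (hrk : ∀ κE : ZpExtension ↥(fixedField (Subgroup.zpowers (absRestrictNormalHom (W.divisionField 3) c))) 3,
      κE.IsCyclotomic → classGroupPRank κE (n + 1) = classGroupPRank κE n) :
    MissingUpperBoundAt W 3 := by
  haveI : NumberField ↥(W.divisionField 3) := NumberField.mk
  exact CartanMuRoadRealDoors.missingUpperBoundAt_three_of_hasSplitCartanNormalizerModPImage_of_realMu W hKatoA hGZK hmod hCS hFW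
    hr hO hirr himg hc
    (fun κE hκE => classicalMuVanishes_of_classGroupPRank_succ_eq hF2 κE
      (CartanMuRoadFukudaDoorsTprime.totallyRamifiedFrom_zero_intermediateField_divisionField W 3 hirr
        (CartanMuRoadFukudaDoorsTprime.not_hasSurjectiveModNGaloisRep_of_hasSplitCartanNormalizerModPImage W himg) _ κE hκE)
      (Nat.zero_le n) (hrk κE hκE))

set_option synthInstance.maxHeartbeats 400000 in
set_option maxHeartbeats 4000000 in
/-- **U₀ at a `3Nn` O6 row from Fukuda Thm. 1 (1) on `ℚ(P)` (degree `8`) at layers `(n, n+1)`, `hram`-FREE, paying `hI`** (named facts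
`hKatoA hGZK hmod hCS hI hFW hF1`; image EQUAL to `C_ns⁺(3)`; `ord₃ h(ℚ(P)_{n+1}) = ord₃ h(ℚ(P)_n)`). CONDITIONAL; nothing booked; BSD
for no curve. [cite: Kato2004Asterisque, Thm. 14.5 (3) (p. 236)] [cite: Fukuda1994, Thm. 1 (1), p. 264] [cite: CoatesSujatha2005, Thm. 3.4 (§3)]
[cite: Serre1972, §2.4 Prop. 15, §5.2 (iv)] [cite: Washington1997, §13.1] -/
theorem missingUpperBoundAt_three_of_hasModPImageEqNonsplitCartanNormalizer_of_realSuccEqAt'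
    (hKatoA : Kato2004.rankZero_padicValNat_sha_add_padicValNat_tamagawa_le_of_additive_potGood_of_irreducible_of_fineSelmerDual_fg)
    (hGZK : rank_eq_analyticRank_of_analyticRank_le_one) (hmod : hasEntireLFunction_rat)
    (hCS : CoatesSujatha2005.thm34_fineSelmerDual_moduleFinite_of_classicalMuVanishes_divisionField)
    (hI : iwasawa1959_classNumberPExp_growth) (hFW : ferreroWashington1979_classicalMuVanishes)
    (hF1 : fukuda1994_thm1_classNumberPExp_const_of_succ_eq)
    [Fact (3 : ℕ).Prime] (hr : W.analyticRank = 0) (hO : ClassO6 W 3) (hirr : W.HasIrreducibleModPGaloisRep 3)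
    (himg : HasModPImageEqNonsplitCartanNormalizer W 3) {c : absoluteGaloisGroup ℚ}
    (hc : IsComplexConjugation (Rat.castHom ℝ) c) (n : ℕ)
    (hord : ∀ κE : ZpExtension ↥(fixedField (Subgroup.zpowers (absRestrictNormalHom (W.divisionField 3) c))) 3,
      κE.IsCyclotomic → classNumberPExp κE (n + 1) = classNumberPExp κE n) :
    MissingUpperBoundAt W 3 := by
  haveI : NumberField ↥(W.divisionField 3) := NumberField.mk
  exact CartanMuRoadRealDoors.missingUpperBoundAt_three_of_hasModPImageEqNonsplitCartanNormalizer_of_realMu' W hKatoA hGZK hmod hCS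
    hI hFW hr hO hirr himg hc
    (fun κE hκE => classicalMuVanishes_of_classNumberPExp_succ_eq hF1 κE
      (CartanMuRoadFukudaDoorsTprime.totallyRamifiedFrom_zero_intermediateField_divisionField W 3 hirr
        (not_hasSurjectiveModNGaloisRep_of_hasNonsplitCartanModPImage W himg.hasNonsplitCartanModPImage) _ κE hκE)
      (Nat.zero_le n) (hord κE hκE))

set_option synthInstance.maxHeartbeats 400000 in
set_option maxHeartbeats 4000000 in
/-- **U₀ at a `3Nn` O6 row from Fukuda Thm. 1 (2) (`3`-ranks) on `ℚ(P)` at layers `(n, n+1)`, `hram`-FREE, paying `hI`** (named facts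
`hKatoA hGZK hmod hCS hI hFW hF2`; `rank₃ Cl(ℚ(P)_{n+1}) = rank₃ Cl(ℚ(P)_n)`). CONDITIONAL; nothing booked; BSD for no curve.
[cite: Kato2004Asterisque, Thm. 14.5 (3) (p. 236)] [cite: Fukuda1994, Thm. 1 (2), p. 264] [cite: CoatesSujatha2005, Thm. 3.4 (§3)]
[cite: Serre1972, §2.4 Prop. 15, §5.2 (iv)] -/
theorem missingUpperBoundAt_three_of_hasModPImageEqNonsplitCartanNormalizer_of_realRankSuccEqAt'
    (hKatoA : Kato2004.rankZero_padicValNat_sha_add_padicValNat_tamagawa_le_of_additive_potGood_of_irreducible_of_fineSelmerDual_fg)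
    (hGZK : rank_eq_analyticRank_of_analyticRank_le_one) (hmod : hasEntireLFunction_rat)
    (hCS : CoatesSujatha2005.thm34_fineSelmerDual_moduleFinite_of_classicalMuVanishes_divisionField)
    (hI : iwasawa1959_classNumberPExp_growth) (hFW : ferreroWashington1979_classicalMuVanishes)
    (hF2 : fukuda1994_thm1_classGroupPRank_const_of_succ_eq)
    [Fact (3 : ℕ).Prime] (hr : W.analyticRank = 0) (hO : ClassO6 W 3) (hirr : W.HasIrreducibleModPGaloisRep 3)
    (himg : HasModPImageEqNonsplitCartanNormalizer W 3) {c : absoluteGaloisGroup ℚ}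
    (hc : IsComplexConjugation (Rat.castHom ℝ) c) (n : ℕ)
    (hrk : ∀ κE : ZpExtension ↥(fixedField (Subgroup.zpowers (absRestrictNormalHom (W.divisionField 3) c))) 3,
      κE.IsCyclotomic → classGroupPRank κE (n + 1) = classGroupPRank κE n) :
    MissingUpperBoundAt W 3 := by
  haveI : NumberField ↥(W.divisionField 3) := NumberField.mk
  exact CartanMuRoadRealDoors.missingUpperBoundAt_three_of_hasModPImageEqNonsplitCartanNormalizer_of_realMu' W hKatoA hGZK hmod hCS
    hI hFW hr hO hirr himg hc
    (fun κE hκE => classicalMuVanishes_of_classGroupPRank_succ_eq hF2 κE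
      (CartanMuRoadFukudaDoorsTprime.totallyRamifiedFrom_zero_intermediateField_divisionField W 3 hirr
        (not_hasSurjectiveModNGaloisRep_of_hasNonsplitCartanModPImage W himg.hasNonsplitCartanModPImage) _ κE hκE)
      (Nat.zero_le n) (hrk κE hκE))

end Summit.BirchSwinnertonDyer.BirchSwinnertonDyer.Theorems.CartanMuRoadFukudaDoorsWild

end
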